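import Mathlib
import Summits.Ventures.HodgeRepro.Tier4.Line4.L1Class
import Summits.Ventures.HodgeRepro.Tier4.Line4.L1Closed

/-!
# Tier4/Line4/L1ClosedCor — C-L4-L1CLOSED, the §15-named corollary: `AdaptedClosedUnderL1` for closed families

Blind re-derivation cell `pub-hodge-repro`, Tier 4 «prove the step» (README §9–§10), seat t4-L2-p2 g4 (plan-4 g4's cut
C-L4-L1CLOSED S14751).  `Line4/L1Closed.lean` (p698042) proves the content — a closed invariant constituent is stable
under `R(f)` for every continuous integrable `f` (`R_mem_of_isClosedSub`); with the §15 definitions now on the tree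
(`Common.IsTestL1`, typer-2's L1Convolution; `L1Class.AdaptedClosedUnderL1`, L4-p1's L1Class p699130) the displayed
clause of the adapted family is a THEOREM for families of closed constituents.  The only binders beyond the abstract
setting are `FirstCountableTopology G`, `LocallyCompactSpace G`, `SigmaCompactSpace G` (theorems on `GA W`:
`Line1.secondCountable_GA`, `locallyCompact_GA`, `sigmaCompact_GA`) and `IsClosedSub` per constituent.
HC_CM is NOT proved by anyone in this repository.
-/

set_option autoImplicit false
noncomputable section

namespace Summit.Ventures.HodgeRepro.Tier4.Line4.L1Class

open MeasureTheory Summit.Ventures.HodgeRepro.Tier4.Common Summit.Ventures.HodgeRepro.Tier4.Line1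
  Summit.Ventures.HodgeRepro.Tier4.Line1.RTF Summit.Ventures.HodgeRepro.Tier4.Line4

variable {G : Type} [Group G] [TopologicalSpace G] [IsTopologicalGroup G] [MeasurableSpace G] [BorelSpace G]
  (S : RTF.Setting G)

/-- **C-L4-L1CLOSED**: `AdaptedClosedUnderL1 S τ` for a family of closed invariant constituents
(`R_mem_of_isClosedSub`, L1Closed). -/
theorem adaptedClosedUnderL1_of_isClosedSub [FirstCountableTopology G] [LocallyCompactSpace G]
    [SigmaCompactSpace G] (τ : ℕ → Set (G → ℂ)) (hinv : ∀ m, S.IsInvariantSubspace (τ m))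
    (hcl : ∀ m, IsClosedSub S (τ m)) : AdaptedClosedUnderL1 S τ :=
  fun m _ hφ _ hf => R_mem_of_isClosedSub S (hinv m) (hcl m) hφ hf.1 hf.2

end Summit.Ventures.HodgeRepro.Tier4.Line4.L1Class

end
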